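import Summits.ResolutionOfSingularities.ResolutionOfSingularities.Theorems.FrobeniusLadderFInjectiveMacaulayficationStubCmGlue
import Summits.ResolutionOfSingularities.ResolutionOfSingularities.Theorems.FrobeniusLadderFInjectiveMacaulayficationReductions
import Summits.ResolutionOfSingularities.ResolutionOfSingularities.Theorems.FrobeniusLadderFRationalResolutionStubClauseOfRingEquiv
import Summits.ResolutionOfSingularities.ResolutionOfSingularities.Theorems.FrobeniusLadderFRationalResolutionStubComponents
import Literature.AlgebraicGeometry.Resolution.ComponentGluing
import Mathlib.AlgebraicGeometry.Noetherian
import Mathlib.AlgebraicGeometry.Morphisms.Proper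
import HarnessLib

/-!
# Reduction to the integral model form (crux `FrobeniusLadder.FRationalModification`, line `Sketch`)

Stub `stub_reduction` of the skeleton `Sketch` for crux stmt-ResolutionOfSingularities-15316 (route
`FrobeniusLadder`, rung 3): a separated finite-type `X/k` with a rung-2 proper birational model
`X₁ → X` (stalks: domain ∧ every system of parameters weakly regular ∧ parameter ideals Frobenius
closed, inline form) has a rung-3 proper birational model `X₂ → X` (stalks: domain ∧ parameter ideals
tightly closed, inline form), GRANTED the integral model form `hint` ("every INTEGRAL separated
finite-type `Y/k` with rung-2 stalks has a proper birational model with rung-3 stalks"). This is the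
purely geometric plumbing of the line; no tight closure argument enters.

Proof. `X₁` is separated, of finite type and quasi-compact over `k` through `π₁ ≫ f` (`π₁` is
proper), hence Noetherian, and it is reduced because its stalks are domains
(`isReduced_of_isReduced_stalk`). Each point of `X₁` lies on exactly one irreducible component, so
every irreducible component `Z` is clopen (`FRationalResolution.Components.isOpen_of_mem_irreducibleComponents`)
and the reduced closed subscheme `X_Z = (vanishingIdeal Z).subscheme ↪ X₁` is an integral OPEN
subscheme (`FRationalResolution.Components.isOpenImmersion_subschemeι_vanishingIdeal`); the rung-2
clause passes to its stalks along the stalk isomorphisms of the open immersion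
(`FInjectiveMacaulayfication.fiClause_of_ringEquiv`), so `hint` gives a rung-3 model of `X_Z` over
`k`. The finitely many models glue into a rung-3 model `X₂ → X₁` as a disjoint union
(`FInjectiveMacaulayfication.exists_model_of_irreducibleComponents`, the rung-3 clause being stable
under binary disjoint unions, `frClause_coprod`), and `X₂ → X₁ → X` is proper (composition) and
birational (`ComponentGluing.IsBirational.comp`).
-/

-- single-problem summit: the doubled namespace component `ResolutionOfSingularities` is forced
set_option linter.dupNamespace false

noncomputable section

open CategoryTheory CategoryTheory.Limits AlgebraicGeometry TopologicalSpace
open Literature.AlgebraicGeometry.Resolution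
open Scheme.IdealSheafData

namespace Summit.ResolutionOfSingularities.ResolutionOfSingularities.Theorems.FRationalModification.Reduction

/-! ## The rung-3 stalk clause on a disjoint union -/

/-- The rung-3 per-stalk clause — "the stalk is a domain and every ideal generated by a system of
parameters (`d = dim` elements generating an ideal with maximal radical) is tightly closed:
`c ≠ 0 ∧ (∀ e, c·y^(p^e) ∈ span {z^(p^e) | z ∈ (s)}) ⇒ y ∈ (s)`" — on all stalks passes to binary
disjoint unions of schemes: every point of `U ⨿ V` comes from `U` or `V` through the open immersions
`coprod.inl`, `coprod.inr`, which induce isomorphisms on stalks, and the clause transports along ring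
isomorphisms (`FRationalResolution.ClauseInvariance.stub_clause_of_ringEquiv`). [folklore] -/
theorem frClause_coprod (p : ℕ) {U V : Scheme.{0}}
    (hU : ∀ x : U, IsDomain (U.presheaf.stalk x) ∧ ∀ d : ℕ, ringKrullDim (U.presheaf.stalk x) = d →
      ∀ s : Fin d → U.presheaf.stalk x, (Ideal.span (Set.range s)).radical.IsMaximal →
        ∀ y c : U.presheaf.stalk x, c ≠ 0 →
          (∀ e : ℕ, c * y ^ p ^ e ∈
            Ideal.span ((fun z : U.presheaf.stalk x => z ^ p ^ e) ''
              (Ideal.span (Set.range s) : Set (U.presheaf.stalk x)))) →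
          y ∈ Ideal.span (Set.range s))
    (hV : ∀ x : V, IsDomain (V.presheaf.stalk x) ∧ ∀ d : ℕ, ringKrullDim (V.presheaf.stalk x) = d →
      ∀ s : Fin d → V.presheaf.stalk x, (Ideal.span (Set.range s)).radical.IsMaximal →
        ∀ y c : V.presheaf.stalk x, c ≠ 0 →
          (∀ e : ℕ, c * y ^ p ^ e ∈
            Ideal.span ((fun z : V.presheaf.stalk x => z ^ p ^ e) ''
              (Ideal.span (Set.range s) : Set (V.presheaf.stalk x)))) →
          y ∈ Ideal.span (Set.range s)) :
    ∀ x : ↥(U ⨿ V), IsDomain ((U ⨿ V).presheaf.stalk x) ∧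
      ∀ d : ℕ, ringKrullDim ((U ⨿ V).presheaf.stalk x) = d →
        ∀ s : Fin d → (U ⨿ V).presheaf.stalk x, (Ideal.span (Set.range s)).radical.IsMaximal →
          ∀ y c : (U ⨿ V).presheaf.stalk x, c ≠ 0 →
            (∀ e : ℕ, c * y ^ p ^ e ∈
              Ideal.span ((fun z : (U ⨿ V).presheaf.stalk x => z ^ p ^ e) ''
                (Ideal.span (Set.range s) : Set ((U ⨿ V).presheaf.stalk x)))) →
            y ∈ Ideal.span (Set.range s) := by
  intro z
  rcases coprod_point_cases z with ⟨x, rfl⟩ | ⟨y, rfl⟩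
  · exact FRationalResolution.ClauseInvariance.stub_clause_of_ringEquiv p
      (asIso ((coprod.inl : U ⟶ U ⨿ V).stalkMap x)).commRingCatIsoToRingEquiv.symm (hU x)
  · exact FRationalResolution.ClauseInvariance.stub_clause_of_ringEquiv p
      (asIso ((coprod.inr : V ⟶ U ⨿ V).stalkMap y)).commRingCatIsoToRingEquiv.symm (hV y)

/-! ## The stub -/

/-- REDUCTION (Sketch `stub_reduction`, folklore): granted the integral model form `hint` (every
INTEGRAL separated finite-type `Y/k` whose stalks are domains with every system of parameters weakly
regular and every parameter ideal Frobenius closed has a proper birational model whose stalks are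
domains with every parameter ideal tightly closed, inline forms), a separated finite-type `X/k` with a
rung-2 proper birational model `X₁ → X` has a rung-3 proper birational model `X₂ → X`: `X₁` is
Noetherian and reduced, its irreducible components are clopen and integral, `hint` applies to each
(the rung-2 clause passing to the open subscheme along the stalk isomorphisms), the models glue as a
disjoint union (`FInjectiveMacaulayfication.exists_model_of_irreducibleComponents`, `frClause_coprod`),
and proper birational morphisms compose (`ComponentGluing.IsBirational.comp`).
[cite: CossartPiltant2019, proof of Prop. 4.6, Step 1 (arXiv v1: Prop. 4.4)] -/
theorem stub_reduction (p : ℕ) (k : Type) [Field k] (X : Scheme.{0}) (f : X ⟶ Spec (.of k))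
    [IsSeparated f] [LocallyOfFiniteType f] [QuasiCompact f]
    (hint : ∀ (Y : Scheme.{0}) (g : Y ⟶ Spec (.of k)), IsSeparated g → LocallyOfFiniteType g →
      QuasiCompact g → IsIntegral Y →
      (∀ y : Y, IsDomain (Y.presheaf.stalk y) ∧ ∀ d : ℕ, ringKrullDim (Y.presheaf.stalk y) = d →
        ∀ s : Fin d → Y.presheaf.stalk y, (Ideal.span (Set.range s)).radical.IsMaximal →
          RingTheory.Sequence.IsWeaklyRegular (Y.presheaf.stalk y) (List.ofFn s) ∧
          ∀ w : Y.presheaf.stalk y, (∃ e : ℕ, w ^ p ^ e ∈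
            Ideal.span ((fun z : Y.presheaf.stalk y => z ^ p ^ e) ''
              (Ideal.span (Set.range s) : Set (Y.presheaf.stalk y)))) →
            w ∈ Ideal.span (Set.range s)) →
      ∃ (Y₂ : Scheme.{0}) (ρ : Y₂ ⟶ Y), IsProper ρ ∧ IsBirational ρ ∧ ∀ x : Y₂,
        IsDomain (Y₂.presheaf.stalk x) ∧ ∀ d : ℕ, ringKrullDim (Y₂.presheaf.stalk x) = d →
          ∀ s : Fin d → Y₂.presheaf.stalk x, (Ideal.span (Set.range s)).radical.IsMaximal →
            ∀ y c : Y₂.presheaf.stalk x, c ≠ 0 →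
              (∀ e : ℕ, c * y ^ p ^ e ∈
                Ideal.span ((fun z : Y₂.presheaf.stalk x => z ^ p ^ e) ''
                  (Ideal.span (Set.range s) : Set (Y₂.presheaf.stalk x)))) →
              y ∈ Ideal.span (Set.range s))
    (hX₁ : ∃ (X₁ : Scheme.{0}) (π : X₁ ⟶ X), IsProper π ∧ IsBirational π ∧ ∀ x : X₁,
      IsDomain (X₁.presheaf.stalk x) ∧ ∀ d : ℕ, ringKrullDim (X₁.presheaf.stalk x) = d →
        ∀ s : Fin d → X₁.presheaf.stalk x, (Ideal.span (Set.range s)).radical.IsMaximal →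
          RingTheory.Sequence.IsWeaklyRegular (X₁.presheaf.stalk x) (List.ofFn s) ∧
          ∀ y : X₁.presheaf.stalk x, (∃ e : ℕ, y ^ p ^ e ∈
            Ideal.span ((fun z : X₁.presheaf.stalk x => z ^ p ^ e) ''
              (Ideal.span (Set.range s) : Set (X₁.presheaf.stalk x)))) →
            y ∈ Ideal.span (Set.range s)) :
    ∃ (X₂ : Scheme.{0}) (π : X₂ ⟶ X), IsProper π ∧ IsBirational π ∧ ∀ x : X₂,
      IsDomain (X₂.presheaf.stalk x) ∧ ∀ d : ℕ, ringKrullDim (X₂.presheaf.stalk x) = d →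
        ∀ s : Fin d → X₂.presheaf.stalk x, (Ideal.span (Set.range s)).radical.IsMaximal →
          ∀ y c : X₂.presheaf.stalk x, c ≠ 0 →
            (∀ e : ℕ, c * y ^ p ^ e ∈
              Ideal.span ((fun z : X₂.presheaf.stalk x => z ^ p ^ e) ''
                (Ideal.span (Set.range s) : Set (X₂.presheaf.stalk x)))) →
            y ∈ Ideal.span (Set.range s) := by
  obtain ⟨X₁, π₁, hπ₁, hbir₁, h₂⟩ := hX₁
  haveI := hπ₁
  -- `X₁` is separated, of finite type and quasi-compact over `k` through `π₁ ≫ f`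
  haveI hsep₁ : IsSeparated (π₁ ≫ f) := inferInstance
  haveI hft₁ : LocallyOfFiniteType (π₁ ≫ f) := inferInstance
  haveI hqc₁ : QuasiCompact (π₁ ≫ f) := inferInstance
  -- hence Noetherian, and reduced (its stalks are domains)
  haveI : IsLocallyNoetherian X₁ := LocallyOfFiniteType.isLocallyNoetherian (π₁ ≫ f)
  haveI : CompactSpace X₁ := QuasiCompact.compactSpace_of_compactSpace (π₁ ≫ f)
  haveI : IsNoetherian X₁ := {}
  have hdom : ∀ x : X₁, IsDomain (X₁.presheaf.stalk x) := fun x => (h₂ x).1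
  haveI : IsReduced X₁ := by
    haveI : ∀ x : X₁, _root_.IsReduced (X₁.presheaf.stalk x) := fun x => by
      haveI := hdom x
      infer_instance
    exact isReduced_of_isReduced_stalk X₁
  -- a rung-3 model of each (clopen, integral) irreducible component, by `hint`
  have hres : ∀ Z : Closeds X₁, (Z : Set X₁) ∈ irreducibleComponents X₁ →
      ∃ (Y : Scheme.{0}) (ρ : Y ⟶ (vanishingIdeal Z).subscheme),
        IsProper ρ ∧ IsBirational ρ ∧ ∀ x : Y,
          IsDomain (Y.presheaf.stalk x) ∧ ∀ d : ℕ, ringKrullDim (Y.presheaf.stalk x) = d →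
            ∀ s : Fin d → Y.presheaf.stalk x, (Ideal.span (Set.range s)).radical.IsMaximal →
              ∀ y c : Y.presheaf.stalk x, c ≠ 0 →
                (∀ e : ℕ, c * y ^ p ^ e ∈
                  Ideal.span ((fun z : Y.presheaf.stalk x => z ^ p ^ e) ''
                    (Ideal.span (Set.range s) : Set (Y.presheaf.stalk x)))) →
                y ∈ Ideal.span (Set.range s) := by
    intro Z hZ
    haveI : IsOpenImmersion (vanishingIdeal Z).subschemeι :=
      FRationalResolution.Components.isOpenImmersion_subschemeι_vanishingIdeal Z
        (FRationalResolution.Components.isOpen_of_mem_irreducibleComponents hdom hZ)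
    have hZint : IsIntegral (vanishingIdeal Z).subscheme :=
      ComponentGluing.isIntegral_subscheme_of_mem_irreducibleComponents Z hZ
    exact hint _ ((vanishingIdeal Z).subschemeι ≫ π₁ ≫ f) inferInstance inferInstance inferInstance
      hZint fun u =>
        FInjectiveMacaulayfication.fiClause_of_ringEquiv p
          (asIso ((vanishingIdeal Z).subschemeι.stalkMap u)).commRingCatIsoToRingEquiv
          (h₂ ((vanishingIdeal Z).subschemeι.base u))
  -- glue the models of the components as a disjoint union, and compose with `π₁`
  obtain ⟨X₂, π₂, hπ₂, hbir₂, h₃⟩ :=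
    FInjectiveMacaulayfication.exists_model_of_irreducibleComponents
      (fun Y : Scheme.{0} => ∀ x : Y,
        IsDomain (Y.presheaf.stalk x) ∧ ∀ d : ℕ, ringKrullDim (Y.presheaf.stalk x) = d →
          ∀ s : Fin d → Y.presheaf.stalk x, (Ideal.span (Set.range s)).radical.IsMaximal →
            ∀ y c : Y.presheaf.stalk x, c ≠ 0 →
              (∀ e : ℕ, c * y ^ p ^ e ∈
                Ideal.span ((fun z : Y.presheaf.stalk x => z ^ p ^ e) ''
                  (Ideal.span (Set.range s) : Set (Y.presheaf.stalk x)))) →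
              y ∈ Ideal.span (Set.range s))
      (fun Y hY y => (hY.false y).elim) (fun U V hU hV => frClause_coprod p hU hV) X₁
      NoetherianSpace.finite_irreducibleComponents hres
  haveI := hπ₂
  exact ⟨X₂, π₂ ≫ π₁, inferInstance, ComponentGluing.IsBirational.comp hbir₂ hbir₁, h₃⟩

end Summit.ResolutionOfSingularities.ResolutionOfSingularities.Theorems.FRationalModification.Reduction

end
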